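import Mathlib
import Literature.Computability.AlgebraicComplexity.CommutativeExtensionSimulationSpanning
import Literature.Computability.AlgebraicComplexity.StandardFamilies
import HarnessLib

/-!
# ValiantsHypothesis / TwoAdicLadder — crux `PrecisionLadder` (stmt-ValiantsHypothesis-5948),
# line `Cruxes/PrecisionLadder/Lines/birth.lean`: the BOUNDED-RANK SLICE of the registered stub
# `stub_descent` (helper; the stub itself stays OPEN)

The registered stub `stub_descent` of the line asks for DESCENT WITH POLYNOMIAL OVERHEAD, UNIFORMLY
IN THE PRECISION: for every `c` some `c'` such that for all large `n`, every `k` and every finite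
chain ring `S` of characteristic `2^(k+1)`,
`L_S(per_n) ≤ n^c ⇒ L_{ℤ/2^(k+1)}(per_n) ≤ n^{c'}`.  Its docstring already locates the content:
"simulating its arithmetic over the prime subring `ℤ/2^(k+1)` by structure constants costs a factor
`O(e² f²)`, so the stub says: residue degree `f` and ramification `e` SUPERPOLYNOMIAL in `n` do not
help the permanent superpolynomially".  This file makes the first half of that sentence a theorem
of the tree and thereby isolates the second half as the ENTIRE open content of the stub:

* `complexity_perPoly_zmod_le_of_generators` — for ANY modulus `m`, any commutative ring `S` of
  characteristic `m` generated AS AN ADDITIVE GROUP by a finite family `s : ι → S` (`|ι| = d`),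
  and every `n`:  `L_{ℤ/m}(per_n) ≤ (5d³ + 6d² + 2d) · L_S(per_n) + 3d`.
  This is the tree's spanning-family form of Hrubeš–Yehudayoff 2011 Thm 4.2
  (`Literature.Computability.AlgebraicComplexity.CommExtSimSpan.complexity_zmod_le_of_addSubgroup_closure`:
  structure-constant simulation along a generating family, read back through a `ℤ/m`-linear
  retraction `S → ℤ/m`, which exists because `ℤ/m` is self-injective) applied to `per_n`
  (`map_perPoly`).  No freeness of `S` over `ℤ/m` is needed, so ALL finite chain rings
  `GR(2^(k+1), f)[x]/(g, 2^k x^t)` are covered (`d = e·f` additive generators), not only the free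
  ones (`t = e`).
* `stub_descent_of_boundedGenerators` — the slice with EXPLICIT constants: if `2 ≤ n`, `S` has
  characteristic `2^(k+1)` and is generated additively by `d ≤ n^a` elements, then
  `L_S(per_n) ≤ n^c ⇒ L_{ℤ/2^(k+1)}(per_n) ≤ n^(c + 3a + 4)`, for EVERY `k` (uniform in the
  precision, as the stub demands).
* `stub_descent_slice` — the same in the literal quantifier shape of the registered stub
  (`∀ c, ∃ c', ∀ᶠ n, ∀ k S …`) with ONE inserted hypothesis, "`S` is generated additively by `n^a`
  elements"; `c' = c + 3a + 4`.

What is NOT here (honest framing): the registered stub `stub_descent` quantifies over ALL finite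
chain rings of characteristic `2^(k+1)`, of any size; for chain rings needing `n^{ω(1)}` additive
generators (residue degree or ramification super-polynomial in `n`) nothing is proved here or
anywhere in the tree — that is the open content of the stub ("big chain rings do not help"), and no
descent polynomial in `log f` is known even over fields.  `stub_descent`, `stub_ladderZ` and the crux
`TwoAdicLadder.PrecisionLadder` remain OPEN (open-problem grade); `VP ≠ VNP` is NOT proved and
nothing here is progress on it.  Helper file: no definitions, no named facts, census +0.

Sources: [HrubesYehudayoff2011] Thm 4.2 (via the tree theorem, by name); the stub's own docstring
(`Cruxes/PrecisionLadder/Lines/birth.lean`, STUB 3).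
-/

-- `Summit.ValiantsHypothesis.ValiantsHypothesis.…` is the tree's mandated single-conjunct layout
-- (Sub = Summit), so the duplicated namespace component is intended.
set_option linter.dupNamespace false

namespace Summit.ValiantsHypothesis.ValiantsHypothesis.Theorems.TwoAdicLadderPrecisionLadder

open Literature.Computability.AlgebraicComplexity

/-- **Structure-constant descent for the permanent, any modulus.**  If the commutative ring `S` has
characteristic `m` and is generated as an additive group by `s : ι → S` (`|ι| = d`), then
`L_{ℤ/m}(per_n) ≤ (5d³ + 6d² + 2d) · L_S(per_n) + 3d` for every `n`
(Hrubeš–Yehudayoff simulation along a generating family + a `ℤ/m`-linear retraction `S → ℤ/m`;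
tree `CommExtSimSpan.complexity_zmod_le_of_addSubgroup_closure`, `map_perPoly`).
[cite: HrubesYehudayoff2011, Thm 4.2] -/
theorem complexity_perPoly_zmod_le_of_generators (m : ℕ) [NeZero m] (S : Type*) [CommRing S]
    [CharP S m] {ι : Type*} [Fintype ι] (s : ι → S) (hs : AddSubgroup.closure (Set.range s) = ⊤)
    (n : ℕ) :
    complexity (perPoly (Fin n) (ZMod m)) ≤
      (5 * Fintype.card ι ^ 3 + 6 * Fintype.card ι ^ 2 + 2 * Fintype.card ι) *
        complexity (perPoly (Fin n) S) + 3 * Fintype.card ι := by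
  letI : Algebra (ZMod m) S := ZMod.algebra S m
  have h := CommExtSimSpan.complexity_zmod_le_of_addSubgroup_closure m s hs
    (perPoly (Fin n) (ZMod m))
  rwa [map_perPoly] at h

/-- Arithmetic packaging: `(5d³ + 6d² + 2d) · L + 3d ≤ n ^ (c + 3a + 4)` when `d ≤ n ^ a`,
`L ≤ n ^ c` and `2 ≤ n`. [folklore] -/
theorem simulation_bound_le_pow {n a c d L : ℕ} (hn : 2 ≤ n) (hd : d ≤ n ^ a) (hL : L ≤ n ^ c) :
    (5 * d ^ 3 + 6 * d ^ 2 + 2 * d) * L + 3 * d ≤ n ^ (c + 3 * a + 4) := by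
  have hd3 : d ^ 3 ≤ n ^ (3 * a) := by
    calc d ^ 3 ≤ (n ^ a) ^ 3 := Nat.pow_le_pow_left hd 3
      _ = n ^ (3 * a) := by rw [← pow_mul, mul_comm]
  have hd2 : d ^ 2 ≤ d ^ 3 := by
    rcases Nat.eq_zero_or_pos d with h0 | hpos
    · simp [h0]
    · exact Nat.pow_le_pow_right hpos (by norm_num)
  have hd1 : d ≤ d ^ 3 := by
    rcases Nat.eq_zero_or_pos d with h0 | hpos
    · simp [h0]
    · calc d = d ^ 1 := (pow_one d).symm
        _ ≤ d ^ 3 := Nat.pow_le_pow_right hpos (by norm_num)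
  have hc1 : 1 ≤ n ^ c := Nat.one_le_pow _ _ (by omega)
  have h16 : 16 ≤ n ^ 4 := by
    calc (16 : ℕ) = 2 ^ 4 := by norm_num
      _ ≤ n ^ 4 := Nat.pow_le_pow_left hn 4
  calc (5 * d ^ 3 + 6 * d ^ 2 + 2 * d) * L + 3 * d
      ≤ (5 * d ^ 3 + 6 * d ^ 3 + 2 * d ^ 3) * L + 3 * d ^ 3 :=
        Nat.add_le_add (Nat.mul_le_mul_right _ (Nat.add_le_add
          (Nat.add_le_add le_rfl (Nat.mul_le_mul_left _ hd2)) (Nat.mul_le_mul_left _ hd1)))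
          (Nat.mul_le_mul_left _ hd1)
    _ = 13 * d ^ 3 * L + 3 * d ^ 3 := by ring
    _ ≤ 13 * n ^ (3 * a) * n ^ c + 3 * n ^ (3 * a) :=
        Nat.add_le_add (Nat.mul_le_mul (Nat.mul_le_mul_left _ hd3) hL) (Nat.mul_le_mul_left _ hd3)
    _ ≤ 13 * n ^ (3 * a) * n ^ c + 3 * n ^ (3 * a) * n ^ c := by
        have h3 : 3 * n ^ (3 * a) * 1 ≤ 3 * n ^ (3 * a) * n ^ c := Nat.mul_le_mul_left _ hc1
        rw [mul_one] at h3
        exact Nat.add_le_add_left h3 _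
    _ = 16 * (n ^ (3 * a) * n ^ c) := by ring
    _ ≤ n ^ 4 * (n ^ (3 * a) * n ^ c) := Nat.mul_le_mul_right _ h16
    _ = n ^ (c + 3 * a + 4) := by rw [← pow_add, ← pow_add]; ring_nf

/-- **The bounded-rank slice of `stub_descent`, explicit constants.**  For all `n ≥ 2`, every
precision `k`, and every commutative ring `S` of characteristic `2^(k+1)` generated as an additive
group by `d ≤ n ^ a` elements (e.g. a finite chain ring `GR(2^(k+1), f)[x]/(g, 2^k x^t)` with
`e·f ≤ n^a`): `L_S(per_n) ≤ n ^ c ⇒ L_{ℤ/2^(k+1)}(per_n) ≤ n ^ (c + 3a + 4)` — uniformly in `k`.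
The registered stub `stub_descent` (all chain rings, any size) stays OPEN; this is its
"residue degree and ramification polynomial in `n`" half only. [cite: HrubesYehudayoff2011, Thm 4.2] -/
theorem stub_descent_of_boundedGenerators (c a : ℕ) {n : ℕ} (hn : 2 ≤ n) (k : ℕ) (S : Type*)
    [CommRing S] [CharP S (2 ^ (k + 1))] {d : ℕ} (s : Fin d → S)
    (hs : AddSubgroup.closure (Set.range s) = ⊤) (hd : d ≤ n ^ a)
    (hL : complexity (perPoly (Fin n) S) ≤ n ^ c) :
    complexity (perPoly (Fin n) (ZMod (2 ^ (k + 1)))) ≤ n ^ (c + 3 * a + 4) := by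
  have h := complexity_perPoly_zmod_le_of_generators (2 ^ (k + 1)) S s hs n
  rw [Fintype.card_fin] at h
  exact h.trans (simulation_bound_le_pow hn hd hL)

/-- **The slice in the quantifier shape of the registered stub** (`Cruxes/PrecisionLadder/Lines/
birth.lean`, `Stmt.stub_descent`), with exactly ONE inserted hypothesis — "`S` is generated as an
additive group by `n ^ a` elements (repetitions allowed)" — and the witness `c' = c + 3a + 4`.  The
hypotheses `Fintype S`, `IsLocalRing S`, `IsPrincipalIdealRing S` of the stub are carried but not
used.  The stub itself (no size hypothesis) remains OPEN. [cite: HrubesYehudayoff2011, Thm 4.2] -/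
theorem stub_descent_slice (a : ℕ) :
    ∀ c : ℕ, ∃ c' : ℕ, ∀ᶠ n in Filter.atTop, ∀ (k : ℕ) (S : Type) [CommRing S] [Fintype S],
      IsLocalRing S → IsPrincipalIdealRing S → CharP S (2 ^ (k + 1)) →
      (∃ s : Fin (n ^ a) → S, AddSubgroup.closure (Set.range s) = ⊤) →
      complexity (perPoly (Fin n) S) ≤ n ^ c →
      complexity (perPoly (Fin n) (ZMod (2 ^ (k + 1)))) ≤ n ^ c' := by
  intro c
  refine ⟨c + 3 * a + 4, ?_⟩
  filter_upwards [Filter.eventually_ge_atTop 2] with n hn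
  intro k S _ _ _ _ hchar hgen hL
  obtain ⟨s, hs⟩ := hgen
  haveI := hchar
  exact stub_descent_of_boundedGenerators c a hn k S s hs le_rfl hL

end Summit.ValiantsHypothesis.ValiantsHypothesis.Theorems.TwoAdicLadderPrecisionLadder
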